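import Summits.PneNP.PneNP.Theorems.SoloInformedIOShape
import Literature.Computability.Complexity.PaulPippengerSzemerediTrotter1983Padding
import Literature.Computability.Complexity.PaulPippengerSzemerediTrotter1983
import Literature.Computability.Complexity.TimeConstructibleClosure
import Literature.Computability.Complexity.MurrayWilliams2018Lemma13
import Literature.Computability.Complexity.NTIMEPadding
import Literature.Computability.Complexity.AaronsonVanMelkebeek2011Proofs
import HarnessLib

/-!
# The linear-time ladder, II: one explicit `NP` language `Wlin` with `Wlin ∈ DTIME(nᵏ) → NTIME(n) ⊆ DTIME(nᵏ⁺¹)`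

Soloist file (`solo-PneNP-informed`, summit-directed charter; landing prefix `SoloInformed`),
companion of `SoloInformedLinearLadder.lean` (the direction `PneNP → ∀ k, NTIME(n) ⊄ DTIME(nᵏ)`, by padding);
the two are combined into `PneNP ↔ ∀ k, NTIME(n) ⊄ DTIME(nᵏ)` and `PneNP ↔ Wlin ∉ P` in
`SoloInformedLinearLadderIff.lean`. This file does not import part I (so that it elaborates
independently). Nothing here is progress toward `P ≠ NP`; it is a kernel-checked SHARPENING OF THE
SUMMIT STATEMENT.

* `SoloLinearLadder.Wlin` — **one explicit `NP` language**
  `Wlin = {z | ∃ y, |y| ≤ |z| ∧ ⟨e, ⟨⟨x, y⟩, u⟩⟩ ∈ U}` (`z = ⟨e, ⟨x, u⟩⟩`; `U ∈ P` the clocked universal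
  acceptance language of the tree, `ClockedUA.U`): bounded universal acceptance at LINEAR scale
  (cf. Aaronson–van Melkebeek 2011, §3.3, `{⟨M, x, t⟩ | M accepts x within t steps}` at exponential
  scale); `Wlin_mem_NP`.
* `soloInformed_NTIME_id_subset_DTIME_pow_succ_of_Wlin_mem_DTIME` —
  **`Wlin ∈ DTIME(nᵏ) → NTIME(n) ⊆ DTIME(nᵏ⁺¹)`**: every `L ∈ NTIME(n)` reduces to `Wlin` by the
  LINEAR-TIME map `x ↦ ⟨code M̃, ⟨x, 1^{K|x|+K}⟩⟩` (`M̃` the truncating, hence total, version of a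
  verifier of `L`; completeness/soundness of `U`: `ClockedUA.complete/sound`; uniqueness of machine
  outputs `AvM.outputsWithin_unique`), computed by an explicit two-stage stack machine — a linear
  unary clock (`exists_linear_unaryClock`) followed by a constant-prefix writer
  (`SoloLinearLadder.exists_machine_prefix`, a three-instruction program in the tree's register
  language `ACom`).
* `soloInformed_exists_NTIME_id_subset_DTIME_pow_of_not_pneNP` — **`¬PneNP → ∃ k ≥ 1, NTIME(n) ⊆ DTIME(nᵏ)`**
  (if `P = NP` then `Wlin ∈ DTIME(nᵏ)` for some `k`).

References: W. Paul, N. Pippenger, E. Szemerédi, W. Trotter, FOCS 1983, 429–438 [PaulEtAl1983];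
S. Aaronson, D. van Melkebeek, *On circuit lower bounds from derandomization*, Theory of Computing 7
(2011), §3.3 [AaronsonMelkebeek2011]; S. Arora, B. Barak, *Computational Complexity* (2009), Thm. 1.9
and §1.4.1 (efficient universal simulation, machines as strings), §2.6.2 [AroraBarakCC2009];
T. Nipkow, G. Klein, *Concrete Semantics* (2014), Ch. 7 (big-step reasoning for the register
programs). All ingredients are tree theorems; standard axioms only.
-/

namespace Summit.PneNP.PneNP.Theorems

open Literature.Computability.Complexity _root_.Computability Turing Polynomial Brick

/-! ### The converse: one explicit language, linear-time reductions -/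

namespace SoloLinearLadder

open Literature.Computability.Complexity.UnaryClock Literature.Computability.Complexity.ACom

/-- `prefixProg w`: prepend the constant word `w` to the input, `z ↦ w ++ z` (pour the input to
the scratch register and back to the output, then push `w` reversed). [folklore] -/
def prefixProg (w : List Bool) : Prog :=
  pour .inp .xr ;; pour .xr .out ;; pushList .out w.reverse

/-- Effect and cost of `prefixProg w`: `6 |z| + |w| + 2` steps. [folklore] -/
theorem runs_prefixProg (w z : List Bool) :
    Runs (prefixProg w) (mk z [] [] [] [] []) (mk [] [] [] [] [] (w ++ z))
      (6 * z.length + w.length + 2) := by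
  unfold prefixProg
  have h1 := runs_pour (Γ := Bool) (a := Rg.inp) (b := Rg.xr) (by decide) (mk z [] [] [] [] [])
  simp only [mk_inp, mk_xr, List.append_nil, update_mk_inp, update_mk_xr] at h1
  have h2 := runs_pour (Γ := Bool) (a := Rg.xr) (b := Rg.out) (by decide)
    (mk [] z.reverse [] [] [] [])
  simp only [mk_xr, mk_out, List.reverse_reverse, List.append_nil, update_mk_xr, update_mk_out,
    List.length_reverse] at h2
  have h3 := runs_pushList (Γ := Bool) Rg.out w.reverse (mk [] [] [] [] [] z)
  simp only [mk_out, update_mk_out, List.reverse_reverse, List.length_reverse] at h3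
  exact (h1.seq (h2.seq h3)).of_eq rfl (by omega)

/-- **The constant-prefix machine**: `z ↦ w ++ z` within `6 |z| + |w| + 3` steps. [folklore] -/
theorem exists_machine_prefix (w : List Bool) : ∃ M : TM2ComputableAux Bool Bool,
    ∀ z : List Bool, M.OutputsWithin z (w ++ z) (6 * z.length + w.length + 3) := by
  obtain ⟨M, hM⟩ := ACom.exists_computesInTime (prefixProg w) .inp .out
    (fun z : List Bool => z) id (fun z => w ++ z) (fun z => 6 * z.length + w.length + 2)
    (fun z => by rw [single_inp, single_out]; exact runs_prefixProg w z)
  exact ⟨M, fun z => hM z⟩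

/-- The re-layout `⟨⟨e, ⟨x, u⟩⟩, y⟩ ↦ ⟨e, ⟨⟨x, y⟩, u⟩⟩` feeding the universal acceptance language,
as a composite of pair projections. [folklore] -/
noncomputable def relay3 : List Bool → List Bool :=
  fanoutFn (fstF ∘ fstF)
    (fanoutFn (fanoutFn (fstF ∘ sndF ∘ fstF) sndF) (sndF ∘ sndF ∘ fstF))

/-- `relay3 ∈ FP`. [folklore] -/
theorem relay3_mem_FP : relay3 ∈ FP :=
  fanoutFn_mem_FP (comp_mem_FP fstF_mem_FP fstF_mem_FP)
    (fanoutFn_mem_FP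
      (fanoutFn_mem_FP (comp_mem_FP fstF_mem_FP (comp_mem_FP sndF_mem_FP fstF_mem_FP)) sndF_mem_FP)
      (comp_mem_FP sndF_mem_FP (comp_mem_FP sndF_mem_FP fstF_mem_FP)))

/-- The value of `relay3` on a well-formed argument. [folklore] -/
theorem relay3_apply (e x u y : List Bool) :
    relay3 (boolPair (boolPair e (boolPair x u)) y) = boolPair e (boolPair (boolPair x y) u) := by
  simp [relay3, Function.comp]

/-- **The complete language** `Wlin = {z | ∃ y, |y| ≤ |z| ∧ relay3 ⟨z, y⟩ ∈ U}`: an instance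
`z = ⟨e, ⟨x, u⟩⟩` is accepted iff some inner witness `y` no longer than the instance makes the
universal acceptance language `ClockedUA.U` accept `⟨e, ⟨⟨x, y⟩, u⟩⟩`, i.e. iff the machine coded
by `e` outputs `[true]` on `⟨x, y⟩` within the budget `|u| / haltAddr`. (Cf. Aaronson–van Melkebeek
2011, §3.3, `{⟨M, x, t⟩ | M accepts x within t steps}`, here at linear rather than exponential
scale.) [cite: AroraBarakCC2009, Thm. 1.9 and §1.4.1] -/
def Wlin : Language Bool :=
  {z | ∃ y : List Bool, y.length ≤ z.length ∧ boolPair z y ∈ relay3 ⁻¹' ClockedUA.U}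

/-- `Wlin ∈ NP` (witness bound the identity polynomial; core `relay3⁻¹ U ∈ P`).
[cite: AroraBarakCC2009, Thm. 1.9 and §1.4.1] -/
theorem Wlin_mem_NP : Wlin ∈ Nondeterministic.NP := by
  refine ⟨relay3 ⁻¹' ClockedUA.U, preimage_mem_P ClockedUA.U_mem_P relay3_mem_FP, X, fun z => ?_⟩
  simp only [eval_X]
  rfl

/-- The instance of `x` for the machine `M` with budget slope `K`: `⟨code M, ⟨x, 1^{K|x|+K}⟩⟩`.
[folklore] -/
noncomputable def linInst (M : TM2ComputableAux Bool Bool) (K : ℕ) (x : List Bool) : List Bool :=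
  ClockedUA.inst M x (List.replicate (K * x.length + K) true)

/-- Length of the instance: affine in `|x|`. [folklore] -/
theorem length_linInst (M : TM2ComputableAux Bool Bool) (K : ℕ) (x : List Bool) :
    (linInst M K x).length = (K + 2) * x.length + (2 * (ClockedUA.code M).length + 4 + K) := by
  simp only [linInst, ClockedUA.inst, length_boolPair, List.length_replicate]
  ring

/-- The instance is the constant prefix `⟨code M, ε⟩` followed by the clock word `⟨x, 1^{K|x|+K}⟩`.
[folklore] -/
theorem prefix_append_eq_linInst (M : TM2ComputableAux Bool Bool) (K : ℕ) (x : List Bool) :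
    boolPair (ClockedUA.code M) [] ++ boolPair x (List.replicate (K * x.length + K) true) =
      linInst M K x := by
  simp [linInst, ClockedUA.inst, boolPair, List.append_assoc]

/-- Arithmetic of the truncating verifier: its time on a short witness is `≤ D n + D`. [folklore] -/
theorem verifier_arith (a c n yl : ℕ) (hy : yl ≤ c * n + c) :
    c * n + c + (a * (c * n + c) + a + 3 * n + 2 * (c * n + c) + 2 * n + yl / 2 + 11) ≤
      (a * c + a + 4 * c + 16) * n + (a * c + a + 4 * c + 16) := by
  have hy2 : yl / 2 ≤ c * n + c := (Nat.div_le_self _ _).trans hy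
  have e : (a * c + a + 4 * c + 16) * n + (a * c + a + 4 * c + 16) =
      a * (c * n + c) + a * n + 4 * (c * n) + 16 * n + (a + 4 * c + 16) := by ring
  rw [e]
  omega

/-- Arithmetic of the decider: clock + prefix writer + `nᵏ`-time decider on an affine-length
instance is `O(nᵏ⁺¹)`. [folklore] -/
theorem ladder_arith (a' K E a₂ C₁ k n P : ℕ) (hP : P ≤ C₁ * n ^ k + C₁) :
    a₂ * P + a₂ + (6 * (2 * n + 2 + (K * n + K)) + (2 * E + 2) + 3) + (a' * (K * n + K) + a') ≤
      (a' * K + a' + 6 * K + 2 * E + 17 + 2 * (a₂ * C₁) + a₂) * n ^ (k + 1) +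
        (a' * K + a' + 6 * K + 2 * E + 17 + 2 * (a₂ * C₁) + a₂) := by
  set m := n ^ (k + 1) with hm
  have hn : n ≤ m := Nat.le_self_pow (Nat.succ_ne_zero k) n
  have hk : n ^ k ≤ m + 1 := by
    rcases Nat.eq_zero_or_pos n with rfl | hpos
    · cases k <;> simp [hm]
    · exact (Nat.pow_le_pow_right hpos (Nat.le_succ k)).trans (Nat.le_succ _)
  have h1 : a' * (K * n + K) ≤ a' * (K * m) + a' * K := by
    rw [← Nat.mul_add]
    exact Nat.mul_le_mul_left _ (Nat.add_le_add_right (Nat.mul_le_mul_left _ hn) _)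
  have h2 : K * n ≤ K * m := Nat.mul_le_mul_left _ hn
  have h3 : a₂ * P ≤ a₂ * (C₁ * m) + (a₂ * C₁ + a₂ * C₁) := by
    calc a₂ * P ≤ a₂ * (C₁ * n ^ k + C₁) := Nat.mul_le_mul_left _ hP
      _ ≤ a₂ * (C₁ * (m + 1) + C₁) := by gcongr
      _ = a₂ * (C₁ * m) + (a₂ * C₁ + a₂ * C₁) := by ring
  have e : (a' * K + a' + 6 * K + 2 * E + 17 + 2 * (a₂ * C₁) + a₂) * m =
      a' * (K * m) + a' * m + 6 * (K * m) + 2 * (E * m) + 17 * m +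
        (a₂ * (C₁ * m) + a₂ * (C₁ * m)) + a₂ * m := by ring
  rw [e]
  omega

end SoloLinearLadder

open SoloLinearLadder

/-- **`Wlin ∈ DTIME(nᵏ) ⟹ NTIME(n) ⊆ DTIME(nᵏ⁺¹)`: every nondeterministic linear-time language
reduces to `Wlin` in deterministic LINEAR time.** Given `L ∈ NTIME(n)` with verifier `(c, R, M)`
(`c ≥ 1` by `not_outputsWithin_zero`), let `M̃ = truncMapAux N_c ∘ M` be its truncating version
(total: on every `⟨x, y⟩` it outputs `[R x (y ↾ c|x|+c)]`, within `D|x| + D` steps when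
`|y| ≤ c|x| + c`), `e = code M̃`, `A` its simulation overhead (`ClockedUA.pM M̃ = A · X`) and
`K = A D + D`. Then `x ∈ L ↔ ⟨e, ⟨x, 1^{K|x|+K}⟩⟩ ∈ Wlin`: completeness by `ClockedUA.complete`
(budget `A (D|x| + D) ≤ K|x| + K`), soundness by `ClockedUA.sound` and uniqueness of outputs
(`AvM.outputsWithin_unique`) against the total specification of `M̃`. The instance is written in
linear time by the unary clock `x ↦ ⟨x, 1^{K|x|+K}⟩` (`exists_linear_unaryClock`) followed by the
constant-prefix machine for `⟨e, ε⟩` (`exists_machine_prefix`), and has affine length, so a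
`DTIME(nᵏ)` decider for `Wlin` decides `L` in time `O(nᵏ⁺¹)` (`exists_affine_pow_le`).
[cite: AroraBarakCC2009, Thm. 1.9 and §1.4.1] -/
theorem soloInformed_NTIME_id_subset_DTIME_pow_succ_of_Wlin_mem_DTIME {k : ℕ}
    (hW : Wlin ∈ DTIME (fun n => n ^ k)) :
    NTIME (fun n => n) ⊆ DTIME (fun n => n ^ (k + 1)) := by
  intro L hL
  obtain ⟨c, R, M, hM, hLR⟩ := hL
  dsimp only at hM hLR
  rcases Nat.eq_zero_or_pos c with rfl | hc
  · exact (not_outputsWithin_zero M _ _ (by simpa using hM [] [] (by simp))).elim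
  -- (1) the truncating (total) verifier and its time
  obtain ⟨Nc, a, hNc⟩ := exists_linear_unaryClock hc
  obtain ⟨Mt, hMt⟩ : ∃ Mt : TM2ComputableAux Bool Bool, ∀ x y : List Bool,
      Mt.OutputsWithin (boolPair x y) (encodeBool (R x (y.take (c * x.length + c))))
        (c * x.length + c + (a * (c * x.length + c) + a + 3 * x.length + 2 * (c * x.length + c) +
          2 * x.length + y.length / 2 + 11)) := by
    refine ⟨(truncMapAux Nc).comp M, fun x y => ?_⟩
    have h1 := outputsWithin_truncMapAux_boolPair Nc (y := y) (hNc x)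
    rw [List.length_replicate] at h1
    exact Turing.TM2ComputableAux.comp_outputsWithin _ _ h1
      (hM x (y.take (c * x.length + c)) (List.length_take_le _ _))
  set D : ℕ := a * c + a + 4 * c + 16 with hD
  have hcD : c ≤ D := by omega
  have hMt_short : ∀ x y : List Bool, y.length ≤ c * x.length + c →
      Mt.OutputsWithin (boolPair x y) (encodeBool (R x y)) (D * x.length + D) := by
    intro x y hy
    have h := hMt x y
    rw [List.take_of_length_le hy] at h
    exact h.mono (verifier_arith a c x.length y.length hy)
  -- (2) the overhead and the budget slope
  obtain ⟨A, hA⟩ : ∃ A : ℕ, ∀ t : ℕ, (ClockedUA.pM Mt).eval t = A * t :=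
    ⟨(ClockedUA.pM Mt).eval 1, fun t => by simp [ClockedUA.pM]⟩
  set K : ℕ := A * D + D with hKdef
  have hcK : c ≤ K := hcD.trans (Nat.le_add_left D (A * D))
  have hK1 : 1 ≤ K := by omega
  have hbudget : ∀ n : ℕ, A * (D * n + D) ≤ K * n + K := by
    intro n
    have e : (A * D + D) * n + (A * D + D) = A * (D * n + D) + (D * n + D) := by ring
    rw [hKdef, e]
    exact Nat.le_add_right _ _
  -- (3) the reduction `x ↦ linInst Mt K x` is correct
  have hred : ∀ x : List Bool, x ∈ L ↔ linInst Mt K x ∈ Wlin := by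
    intro x
    constructor
    · intro hx
      obtain ⟨y, hy, hRy⟩ := (hLR x).1 hx
      refine ⟨y, ?_, ?_⟩
      · rw [length_linInst]
        have : c * x.length ≤ K * x.length := Nat.mul_le_mul_right _ hcK
        nlinarith [this, hy, hcK]
      · show relay3 (boolPair (boolPair (ClockedUA.code Mt)
          (boolPair x (List.replicate (K * x.length + K) true))) y) ∈ ClockedUA.U
        rw [relay3_apply]
        have hMy : Mt.OutputsWithin (boolPair x y) [true] (D * x.length + D) := by
          have h := hMt_short x y hy
          rwa [hRy] at h
        exact ClockedUA.complete Mt hMy (by rw [hA]; exact hbudget _)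
    · rintro ⟨y, -, hq⟩
      have hq' : relay3 (boolPair (boolPair (ClockedUA.code Mt)
          (boolPair x (List.replicate (K * x.length + K) true))) y) ∈ ClockedUA.U := hq
      rw [relay3_apply] at hq'
      obtain ⟨t, ht⟩ := ClockedUA.sound Mt hq'
      have heq := AvM.outputsWithin_unique Mt ht (hMt x y)
      have hR : R x (y.take (c * x.length + c)) = true := by
        have he : ∀ b : Bool, encodeBool b = [b] := fun b => rfl
        rw [he] at heq
        simpa using heq.symm
      exact (hLR x).2 ⟨y.take (c * x.length + c), List.length_take_le _ _, hR⟩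
  -- (4) the decider: unary clock, constant prefix, decider of `Wlin`
  obtain ⟨NK, a', hNK⟩ := exists_linear_unaryClock hK1
  obtain ⟨Pf, hPf⟩ := exists_machine_prefix (boolPair (ClockedUA.code Mt) [])
  obtain ⟨a₂, hdec⟩ := hW
  obtain ⟨MW, hMW⟩ := (hdec : TimeDecidable id Wlin fun n => a₂ * n ^ k + a₂)
  obtain ⟨C₁, hC₁⟩ := exists_affine_pow_le (K + 2) (2 * (ClockedUA.code Mt).length + 4 + K) k
  refine ⟨a' * K + a' + 6 * K + 2 * (ClockedUA.code Mt).length + 17 + 2 * (a₂ * C₁) + a₂,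
    NK.comp (Pf.comp MW), fun x => ?_⟩
  simp only [id]
  have hind : Wlin.boolIndicator (linInst Mt K x) = L.boolIndicator x := by
    rw [Bool.eq_iff_iff]
    exact (Set.mem_iff_boolIndicator _ _).symm.trans
      ((hred x).symm.trans (Set.mem_iff_boolIndicator _ _))
  have h1 := hNK x
  have h2 := hPf (boolPair x (List.replicate (K * x.length + K) true))
  rw [prefix_append_eq_linInst] at h2
  simp only [length_boolPair, List.length_replicate, List.length_nil, add_zero] at h2
  have h3 := hMW (linInst Mt K x)
  simp only [id] at h3
  rw [hind] at h3
  have h := Turing.TM2ComputableAux.comp_outputsWithin _ _ h1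
    (Turing.TM2ComputableAux.comp_outputsWithin _ _ h2 h3)
  refine h.mono ?_
  have hP : (linInst Mt K x).length ^ k ≤ C₁ * x.length ^ k + C₁ := by
    rw [length_linInst]
    exact hC₁ _
  exact ladder_arith a' K (ClockedUA.code Mt).length a₂ C₁ k x.length _ hP

/-- **`¬ PneNP → ∃ k ≥ 1, NTIME(n) ⊆ DTIME(nᵏ)`**: if `P = NP` then the explicit `NP` language
`Wlin` is in some `DTIME(nᵏ)`, and then `NTIME(n) ⊆ DTIME(nᵏ⁺¹)`
(`soloInformed_NTIME_id_subset_DTIME_pow_succ_of_Wlin_mem_DTIME`). [cite: AroraBarakCC2009, Thm. 1.9 and §1.4.1] -/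
theorem soloInformed_exists_NTIME_id_subset_DTIME_pow_of_not_pneNP (h : ¬ PneNP) :
    ∃ k : ℕ, 1 ≤ k ∧ NTIME (fun n => n) ⊆ DTIME (fun n => n ^ k) := by
  have hWP : Wlin ∈ Classes.P := by
    by_contra hW
    exact h (soloInformed_pneNP_iff_exists_not_mem.2 ⟨Wlin, Wlin_mem_NP, hW⟩)
  simp only [Classes.P, Set.mem_iUnion] at hWP
  obtain ⟨k, hk⟩ := hWP
  exact ⟨k + 1, Nat.succ_pos k, soloInformed_NTIME_id_subset_DTIME_pow_succ_of_Wlin_mem_DTIME hk⟩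

end Summit.PneNP.PneNP.Theorems
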